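import Summits.ABC.StewartYu.PadicTwistPMHalfValues
import Summits.ABC.StewartYu.PadicComplexLiouville
import Literature.NumberTheory.LFunctions.DworkRationalityBorelDwork
import HarnessLib

/-!
# Cell abc-stewartyu, WP-Y provider B (x): separation at a half point in `ℂ_p`

`Summits/ABC/StewartYu/PadicTwistPMHalfSeparation.lean` — cell `abc-stewartyu`, seat p3 (crux `W80OneModFour`
stmt-ABC-19487; memo-05 §3). ADD-ON: `classSums_eq_zero_of_norm_Φ_half_lt` — in the setting of
`Φ_half_complex_split`, under the SIGNED Kummer condition, `p`-adic smallness of `φ(c)(s/2)` below the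
Liouville threshold `D/(4D²Mb(∏H(allᵢ))³)^{2^{d+2}}` forces BOTH signed parity class-sum vectors to vanish
(p3's `TwistHalf.norm_evL_add_iota_mul_ge` in `ℂ_p`, `hZ` = Dwork's `norm_intCast_le_one`, `hN` =
`PadicComplexFacts.inv_natCast_le_norm_natCast`). Kernel-checked beforehand in
HOME/p3/lean/pm/CHECK_PM_chain.lean. [folklore].
-/

noncomputable section

open NormedSpace Finset IsUltrametricDist
open Literature.NumberTheory.Transcendental
open Literature.NumberTheory.Transcendental.CW77.Setup (Idx Tau tauNorm)
open scoped Nat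

namespace Summit.ABC.StewartYu

/-! ## HalfStepPM (provider B), part 3 — separation at a half point: `p`-adic smallness of `φ(c)(s/2)`
forces BOTH signed class-sum vectors to vanish (memo-05 §3; the ℂ_p Liouville of `TwistHalf`). -/

namespace TwistSetup

variable {p : ℕ} [Fact p.Prime] (S : TwistSetup p) {h Lb : ℕ}

/-- **Separation at a half point (provider B).** In the setting of `Φ_half_complex_split` (roots `ŝᵢ` of the
generators in `ℂ_p` with `‖ŝᵢ‖ ≤ 1`, `‖ξ‖ = 1`, the ± exponent class on the box), under the SIGNED Kummer
condition on the generators: if the two signed class-sum vectors `C₀, C₁` (even / odd `k`) have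
`D·C_b ∈ ℤ`, `∑|C₀| + ∑|C₁| ≤ Mb` and `‖φ(c)(s/2)‖_p < D/(4D²Mb(∏H(allᵢ))³)^{2^{d+2}}`, then
`C₀ = 0` and `C₁ = 0`. [folklore] -/
theorem classSums_eq_zero_of_norm_Φ_half_lt {J₀ J : ℕ} (hJ : J < J₀) (box : Finset (Idx S.d h Lb))
    (c : Idx S.d h Lb → ℤ) (τ : Tau S.d) (s : ℕ) (ŝ : Fin (S.d + 1) → ℂ_[p]) (ξ ιC : ℂ_[p])
    (r : Fin (S.d + 1) → ℕ) {M c₀ : ℕ} (k : Idx S.d h Lb → ℕ)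
    (hσ : ∀ i, algebraMap ℚ_[p] ℂ_[p] (PadicExp.psqrt (S.ω i)) = ŝ i * ξ ^ r i)
    (hι : ξ ^ M = ιC) (hι2 : ιC ^ 2 = -1) (hξ : ‖ξ‖ = 1)
    (hcls : ∀ u ∈ box, ∑ i, r i * S.frame.expn u s i = c₀ + k u * M)
    (hŝ : ∀ i, ŝ i * ŝ i = (S.toQ.all i : ℂ_[p])) (hŝ1 : ∀ i, ‖ŝ i‖ ≤ 1)
    (hind : ∀ T : Finset (Fin (S.d + 1)), T.Nonempty →
      ¬ IsSquare (∏ j ∈ T, S.toQ.all j) ∧ ¬ IsSquare (-∏ j ∈ T, S.toQ.all j))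
    {D : ℕ} (hD : 1 ≤ D) {Mb : ℝ} (hMb : 1 ≤ Mb)
    (hden₀ : ∀ T', ∃ z : ℤ, (D : ℚ) * (∑ u ∈ (box.filter (fun u => Even (k u))) with S.toQ.flat.Sset u s = T',
        (((-1) ^ (k u / 2) * c u : ℤ) : ℚ) *
          ((S.frame.qΔ J₀ (J + 1) u τ.1 s * S.frame.qA u τ.2) * S.toQ.qEh u s)) = z)
    (hden₁ : ∀ T', ∃ z : ℤ, (D : ℚ) * (∑ u ∈ (box.filter (fun u => ¬ Even (k u))) with S.toQ.flat.Sset u s = T',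
        (((-1) ^ (k u / 2) * c u : ℤ) : ℚ) *
          ((S.frame.qΔ J₀ (J + 1) u τ.1 s * S.frame.qA u τ.2) * S.toQ.qEh u s)) = z)
    (hcM : ∑ T', |((∑ u ∈ (box.filter (fun u => Even (k u))) with S.toQ.flat.Sset u s = T',
        (((-1) ^ (k u / 2) * c u : ℤ) : ℚ) *
          ((S.frame.qΔ J₀ (J + 1) u τ.1 s * S.frame.qA u τ.2) * S.toQ.qEh u s) : ℚ) : ℝ)| +
      ∑ T', |((∑ u ∈ (box.filter (fun u => ¬ Even (k u))) with S.toQ.flat.Sset u s = T',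
        (((-1) ^ (k u / 2) * c u : ℤ) : ℚ) *
          ((S.frame.qΔ J₀ (J + 1) u τ.1 s * S.frame.qA u τ.2) * S.toQ.qEh u s) : ℚ) : ℝ)| ≤ Mb)
    (hlt : ‖S.Φ J₀ J box c τ ((2 : ℚ_[p])⁻¹ * (s : ℚ_[p]))‖ <
      (D : ℝ) / (4 * (D : ℝ) ^ 2 * Mb *
        Literature.NumberTheory.Transcendental.CW77.heightProd S.toQ.all ^ 3) ^ (2 ^ (S.d + 1 + 1))) :
    (fun T' => ∑ u ∈ (box.filter (fun u => Even (k u))) with S.toQ.flat.Sset u s = T',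
        (((-1) ^ (k u / 2) * c u : ℤ) : ℚ) *
          ((S.frame.qΔ J₀ (J + 1) u τ.1 s * S.frame.qA u τ.2) * S.toQ.qEh u s)) = 0 ∧
    (fun T' => ∑ u ∈ (box.filter (fun u => ¬ Even (k u))) with S.toQ.flat.Sset u s = T',
        (((-1) ^ (k u / 2) * c u : ℤ) : ℚ) *
          ((S.frame.qΔ J₀ (J + 1) u τ.1 s * S.frame.qA u τ.2) * S.toQ.qEh u s)) = 0 := by
  classical
  set C₀ : Finset (Fin (S.d + 1)) → ℚ := fun T' =>
    ∑ u ∈ (box.filter (fun u => Even (k u))) with S.toQ.flat.Sset u s = T',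
      (((-1) ^ (k u / 2) * c u : ℤ) : ℚ) *
        ((S.frame.qΔ J₀ (J + 1) u τ.1 s * S.frame.qA u τ.2) * S.toQ.qEh u s) with hC₀
  set C₁ : Finset (Fin (S.d + 1)) → ℚ := fun T' =>
    ∑ u ∈ (box.filter (fun u => ¬ Even (k u))) with S.toQ.flat.Sset u s = T',
      (((-1) ^ (k u / 2) * c u : ℤ) : ℚ) *
        ((S.frame.qΔ J₀ (J + 1) u τ.1 s * S.frame.qA u τ.2) * S.toQ.qEh u s) with hC₁
  by_contra hne
  -- the value in `ℂ_p`
  have hval : algebraMap ℚ_[p] ℂ_[p] (S.Φ J₀ J box c τ ((2 : ℚ_[p])⁻¹ * (s : ℚ_[p]))) =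
      (2 : ℂ_[p]) ^ τ.1 * (ξ ^ c₀ * (Multiquad.evL ŝ C₀ + ιC * Multiquad.evL ŝ C₁)) := by
    rw [S.Φ_half_complex_split hJ box c τ s ŝ ξ ιC r k hσ hι hι2 hcls,
      S.half_sum_eq_evL _ c τ s ŝ hŝ k, S.half_sum_eq_evL _ c τ s ŝ hŝ k]
  -- norms: `‖φ(s/2)‖_p = ‖evL ŝ C₀ + ι evL ŝ C₁‖`
  have h2 : ‖(2 : ℂ_[p])‖ = 1 := by
    rw [← map_ofNat (algebraMap ℚ_[p] ℂ_[p]) 2,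
      show algebraMap ℚ_[p] ℂ_[p] (2 : ℚ_[p]) = ((2 : ℚ_[p]) : ℂ_[p]) from rfl,
      PadicComplex.norm_extends']
    exact PadicExp.norm_two_eq_one S.hp3
  have hnorm : ‖S.Φ J₀ J box c τ ((2 : ℚ_[p])⁻¹ * (s : ℚ_[p]))‖ =
      ‖Multiquad.evL ŝ C₀ + ιC * Multiquad.evL ŝ C₁‖ := by
    rw [← PadicComplex.norm_extends', show ((S.Φ J₀ J box c τ ((2 : ℚ_[p])⁻¹ * (s : ℚ_[p])) : ℚ_[p]) : ℂ_[p]) =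
      algebraMap ℚ_[p] ℂ_[p] (S.Φ J₀ J box c τ ((2 : ℚ_[p])⁻¹ * (s : ℚ_[p]))) from rfl, hval,
      norm_mul, norm_mul, norm_pow, norm_pow, h2, hξ, one_pow, one_pow, one_mul, one_mul]
  -- Liouville in `ℂ_p`
  have hιmul : ιC * ιC = -1 := by rw [← pow_two]; exact hι2
  have key := TwistHalf.norm_evL_add_iota_mul_ge
    (L := ℂ_[p]) (fun z => Literature.NumberTheory.LFunctions.Dwork.norm_intCast_le_one p z)
    (fun n hn => PadicComplexFacts.inv_natCast_le_norm_natCast hn) S.toQ.all hind ŝ hŝ hŝ1 ιC hιmul C₀ C₁ hne D hD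
    hden₀ hden₁ Mb hMb hcM
  rw [hnorm] at hlt
  exact absurd (lt_of_le_of_lt key hlt) (lt_irrefl _)

end TwistSetup



end Summit.ABC.StewartYu

end
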